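import Summits.QuantumFields.YangMills.Theorems.BalabanUVNodesN18RunWindowEdgeRecord
import Summits.QuantumFields.YangMills.Theorems.BalabanUVNodesN17RunWindowShift

/-!
# NODE N17 (NE4) — FILE 9: THE RUN-CURRENCY ROAD U3 → N17 → DEF-1's RUN LETTER, KNIT BY NAME — dag-n18-w1's run-window edge (N18's η-rate read ONLY along the sliding windows of
# in-window runs, through the kernels of record, + the (D4) read-out ⟹ this seat's run-window N17 text) ∘ FILE 5's run-keyed lever (⟹ `RunRemAt F κ θ hP θ.cβ` given DEF-1's
# anchor at the named numbers and survivor continuity at one level) — NO box letter on either node's side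

Cell `pub-ymgap`, YM-PLAN Track A (HUMAN RULINGS D-0062 ∕ D-0149), WIDTH SEAT `pub-ymgap-dag-n17-w1` (generation 6), CLAIM-4 ∕ INTENT-4.  Key K3⁸ stmt-QuantumFields-27366
`SpineGivenEndpointR13SepCoPHV` (`--kind proof --supports stmt-QuantumFields-27366 --as helper`, COUNT-NEUTRAL).  Imports dag-n18-w1 g6's FILE 4 `…N18RunWindowEdgeRecord` (record ∕ pin
edition of the U3 → U2 edge in run-window currency, R-N18-RUN constructive half) and this seat's FILE 5 p608124 `…N17RunWindowShift` (the lever keyed on sliding windows of in-window runs).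

WHY.  dag-n18-w1's edge files reproduce FILE 5's run-window N17 hypothesis `hW` VERBATIM as their CONCLUSION but do not import FILE 5 (theses-cone hygiene on their side); FILE 5's ★★
`runRemAt_of_runWindowShift_scaleAnchor_survContAt` consumes exactly that text.  This file is the two-line junction, so that the tree holds BY NAME the complete run-currency road
«run-window kernel step rate of record (node N18 in SHIFT form along the runs) + (D4) `ReadOutAt` at node U3's bundle of record + DEF-1's `ScaleAnchor` at `θ.cβ • beta0OfJs F κ`
+ `SurvCont` at one positive level ⟹ `RunRemAt F κ θ hP θ.cβ`» — at the kernels of record (§1) and under K3's reading pin `U3PinnedKernels` (§2) — with NO box-keyed letter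
(`N17At` ∕ `N18At` ∕ `KernelStepRate(OfRecord₁₃)`) anywhere on the road: the keying both seats located as the one surviving the ym-nodeO F-E shadow (dag-n18-w1 FILE 1 ∕ this seat's
FILE 7–8).  §3 records that today's BOX conjunct `N18At` at the pinned bundle is MORE than enough (dag-n18-w1's `runWindowKernelStepRate_of_n18At_pin`), i.e. re-keying per R-N18-RUN ∕
R-N17-RUN only WEAKENS what stub 1's witness owes this road.
HONEST SCOPE (A6).  By-name composition of landed theorems over hypothesis SHAPES: the run-window kernel step rate, (D4), the anchor, (C), admissibility and the provisos are BINDERS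
inhabited at no θ here; the modulus `ℓ.cr·ℓ.C₅·ℓ.θ₅·ℓ.θ₅^k` is summable for `0 ≤ ℓ.θ₅ < 1` (the only place a rate letter is read — geometric is sufficient, not necessary: FILE 5's lever
takes any summable modulus).  NOTHING of Bałaban asserted or instantiated; NE4 ∕ NE5 NOT IN PRINT for d = 4 ([Balaban1987RG1] p. 264, Thm 1 p. 259) and NOT proved; NOT a proof of
`stub_rates13HV` ∕ `stub_expansion13HV` or any K1⁹ stub; N17 ∕ N18 NOT discharged; K0⁷ ∕ K1⁹ ∕ K3⁸ OPEN; counts UNMOVED (typed 28∕28 · discharged 5∕27 · A 5∕28).  One finite four-torus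
programme at fixed `ε = L^{−K}`, Bałaban AS PRINTED; the YM mass gap (Clay) is NOT proved by any of this — R4 closes the conditional finite-𝕋⁴ rung `BalabanLadder.UV` only; nothing continuum ∕ ℝ⁴ ∕ OS.
[I] = [Balaban1987RG1] T. Bałaban, CMP **109** (1987): (0.18)–(0.20) pp. 255–256, Thm 1 ∕ Thm 2 p. 259, (1.20)–(1.22) p. 264, Thm 3 p. 264, (2.12)–(2.14) p. 268.
-/

noncomputable section

namespace Summit.QuantumFields.YangMills.BalabanUVNodes.N17RunRemAtOfRunWindowKernels

open Literature.MathematicalPhysics.QuantumFieldTheory.Balaban1983to89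
open Literature.MathematicalPhysics.QuantumFieldTheory.Balaban1983to89.T4Continuum (T4Family ULoop)
open Literature.MathematicalPhysics.QuantumFieldTheory.Balaban1983to89.FlowStep (HBeta prefixOf RGEqH)
open Literature.MathematicalPhysics.QuantumFieldTheory.Balaban1983to89.Node00 (U3Letters₁₁ Stage13HParams)
open Literature.MathematicalPhysics.QuantumFieldTheory.Balaban1983to89.Node00.U3OfKernels (pt objectsOfRecord₁₃)
open Literature.MathematicalPhysics.QuantumFieldTheory.Balaban1983to89.B12Sec2to5 (l1)
open Summit.QuantumFields.YangMills.Theorems.BalabanUVNodesK2JsOfRecord (StepColourData beta0OfJs)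
open Summit.QuantumFields.YangMills.Theorems.BalabanUVNodesK2NamedJetsRemAt (ScaleAnchor)
open Summit.QuantumFields.YangMills.Theorems.BalabanUVNodesK2NamedJetsRunRemAt (RunRemAt SurvCont)
open Summit.QuantumFields.YangMills.BalabanUVNodes.N17RunWindowShift (runRemAt_of_runWindowShift_scaleAnchor_survContAt)
open YMDAG.N18.RunWindowEdge (runWindowShift_of_readOutAt_objectsOfRecord₁₃_runWindowKernelStepRate runWindowShift_of_readOutAt_pin_runWindowKernelStepRate
  runWindowKernelStepRate_of_n18At_pin)
open YMDAG.UVSplit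

variable (F : T4Family) (κ : StepColourData) (θ : Stage13HParams F 2) (hP : θ.Provisos₁₃SepCoPH F 2)

/-- A geometric modulus `C·θ₅^k` with `0 ≤ θ₅ < 1` is summable (the one place this road reads a rate; FILE 5's lever takes any summable modulus). [folklore] -/
theorem summable_geomModulus {C θ₅ : ℝ} (h0 : 0 ≤ θ₅) (h1 : θ₅ < 1) : Summable fun k : ℕ => C * θ₅ ^ k :=
  (summable_geometric_of_lt_one h0 h1).mul_left C

/-! ## §1 At the kernels of record `objectsOfRecord₁₃ F 2 θ ℓ` (node U3's bundle `u3OfRecord₁₃ θ … kk`) -/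

/-- ★★★ **THE RUN-CURRENCY ROAD, KERNELS-OF-RECORD EDITION**: at an admissible proviso'd Stage-13 tuple, (D4) `ReadOutAt` at node U3's bundle of record built on W1-19's kernels of record
+ THE RUN-WINDOW KERNEL STEP RATE OF RECORD along the in-window runs of the datum's β (node N18 in shift form, first coupling = the run's own `g_j`; `0 ≤ ℓ.θ₅ < 1`) + DEF-1's ANCHOR
at `θ.cβ • beta0OfJs F κ` + survivor continuity at ONE positive level ⟹ `RunRemAt F κ θ hP θ.cβ` — dag-n18-w1's `runWindowShift_of_readOutAt_objectsOfRecord₁₃_runWindowKernelStepRate`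
∘ FILE 5's `runRemAt_of_runWindowShift_scaleAnchor_survContAt`.  NO box letter on the road.  CONDITIONAL on every displayed binder. [cite: Balaban1987RG1, (0.18)–(0.20) pp.255–256, (1.20)–(1.22) p.264, Thm 3 p.264 and (2.12)–(2.14) p.268] -/
theorem runRemAt_of_readOutAt_objectsOfRecord₁₃_runWindowKernelStepRate_scaleAnchor_survContAt (hθ : θ.Admissible F 2) (ℓ : U3Letters₁₁) (kk : ℕ)
    (hθ₅ : 0 ≤ ℓ.θ₅) (hθ₅1 : ℓ.θ₅ < 1)
    (hD4 : ReadOutAt (Node00.datumOfRecord₁₃SepCoPH F 2 θ hP) (u3OfRecord₁₃ θ.toStage13Params (objectsOfRecord₁₃ F 2 θ.toStage13Params ℓ) kk))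
    (h18run : ∀ (n : ℕ) (gs : ℕ → ℝ), RGEqH n (Node00.datumOfRecord₁₃SepCoPH F 2 θ hP).βfun gs → Step.InInterval θ.γ n gs → ∀ j k : ℕ, j + (k + 1) ≤ n →
      ∀ (μ ν : Fin 4) (z : Fin 4 → ℤ),
        |(objectsOfRecord₁₃ F 2 θ.toStage13Params ℓ).EA 0 (fun i => gs (j + 1 + i)) PUnit.unit (pt k μ ν z) -
            (objectsOfRecord₁₃ F 2 θ.toStage13Params ℓ).EA 0 (fun i => gs (j + i)) PUnit.unit (pt (k + 1) μ ν z)| ≤ ℓ.C₅ * ℓ.θ₅ ^ (k + 1) * Real.exp (-(ℓ.κ * l1 z)))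
    (hA : ScaleAnchor (Node00.datumOfRecord₁₃SepCoPH F 2 θ hP).βfun (fun k => θ.cβ * beta0OfJs F κ k))
    {γ₀ : ℝ} (hγ₀ : 0 < γ₀) (hsc : SurvCont (Node00.datumOfRecord₁₃SepCoPH F 2 θ hP).βfun γ₀) :
    RunRemAt F κ θ hP θ.cβ :=
  runRemAt_of_runWindowShift_scaleAnchor_survContAt F κ θ hP hθ (summable_geomModulus (C := ℓ.cr * ℓ.C₅ * ℓ.θ₅) hθ₅ hθ₅1)
    (runWindowShift_of_readOutAt_objectsOfRecord₁₃_runWindowKernelStepRate F 2 θ.toStage13Params ℓ kk _ hD4 h18run) hA hγ₀ hsc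

/-! ## §2 Under K3's reading pin `(𝔯.lit F θ hP.toCore g₀ os).u3 = objectsOfRecord₁₃ F 2 θ (ℓ′ F θ)` (the `U3PinnedKernels` clause at one tuple): (D4) at the BUNDLE OF RECORD -/

/-- ★★★ **THE RUN-CURRENCY ROAD UNDER THE PIN**: with K3's node-U3 pin at the tuple, the (D4) binder `ReadOutAt D (rateCarriersOfRecord₁₃CoPH 𝔯 F θ hP.toCore g₀ os kk).u3` — literally the
second conjunct of `PHolderD4 β D (rrOfRecord 𝔯 ksel F θ hP.toCore g₀ os)` at `kk := ksel …` — + the run-window kernel step rate of record along the datum's in-window runs + DEF-1's anchor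
+ one-level (C) ⟹ `RunRemAt F κ θ hP θ.cβ` (dag-n18-w1's `runWindowShift_of_readOutAt_pin_runWindowKernelStepRate` ∘ FILE 5 ★★).  What stub 1's witness owes THIS road of node N17 is
the run-window kernel letter, not the box conjunct.  CONDITIONAL. [cite: Balaban1987RG1, (0.18)–(0.20) pp.255–256, (1.20)–(1.22) p.264, Thm 3 p.264 and (2.12)–(2.14) p.268] -/
theorem runRemAt_of_readOutAt_pin_runWindowKernelStepRate_scaleAnchor_survContAt (hθ : θ.Admissible F 2) (𝔯 : RateReading₁₃CoPH 2) (g₀ : ℕ → ℝ) (os : List (ULoop F))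
    (ℓ : U3Letters₁₁) (hpin : (𝔯.lit F θ hP.toCore g₀ os).u3 = objectsOfRecord₁₃ F 2 θ.toStage13Params ℓ) (kk : ℕ) (hθ₅ : 0 ≤ ℓ.θ₅) (hθ₅1 : ℓ.θ₅ < 1)
    (hD4 : ReadOutAt (Node00.datumOfRecord₁₃SepCoPH F 2 θ hP) (rateCarriersOfRecord₁₃CoPH 𝔯 F θ hP.toCore g₀ os kk).u3)
    (h18run : ∀ (n : ℕ) (gs : ℕ → ℝ), RGEqH n (Node00.datumOfRecord₁₃SepCoPH F 2 θ hP).βfun gs → Step.InInterval θ.γ n gs → ∀ j k : ℕ, j + (k + 1) ≤ n →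
      ∀ (μ ν : Fin 4) (z : Fin 4 → ℤ),
        |(objectsOfRecord₁₃ F 2 θ.toStage13Params ℓ).EA 0 (fun i => gs (j + 1 + i)) PUnit.unit (pt k μ ν z) -
            (objectsOfRecord₁₃ F 2 θ.toStage13Params ℓ).EA 0 (fun i => gs (j + i)) PUnit.unit (pt (k + 1) μ ν z)| ≤ ℓ.C₅ * ℓ.θ₅ ^ (k + 1) * Real.exp (-(ℓ.κ * l1 z)))
    (hA : ScaleAnchor (Node00.datumOfRecord₁₃SepCoPH F 2 θ hP).βfun (fun k => θ.cβ * beta0OfJs F κ k))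
    {γ₀ : ℝ} (hγ₀ : 0 < γ₀) (hsc : SurvCont (Node00.datumOfRecord₁₃SepCoPH F 2 θ hP).βfun γ₀) :
    RunRemAt F κ θ hP θ.cβ :=
  runRemAt_of_runWindowShift_scaleAnchor_survContAt F κ θ hP hθ (summable_geomModulus (C := ℓ.cr * ℓ.C₅ * ℓ.θ₅) hθ₅ hθ₅1)
    (runWindowShift_of_readOutAt_pin_runWindowKernelStepRate F 𝔯 θ hP.toCore g₀ os ℓ hpin kk _ hD4 h18run) hA hγ₀ hsc

/-! ## §3 Today's BOX conjunct at the pinned bundle is more than enough for this road -/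

/-- **K3 v6's N18 BOX CONJUNCT ⟹ THE SAME CONCLUSION** (so R-N18-RUN ∕ R-N17-RUN only WEAKEN what stub 1's witness owes the road of this file): under the pin, `N18At (rateCarriersOfRecord₁₃CoPH
𝔯 F θ hP.toCore g₀ os kk).u3` gives the run-window kernel letter of record along the runs of ANY β (dag-n18-w1's `runWindowKernelStepRate_of_n18At_pin`), hence with (D4) + anchor + (C): `RunRemAt`.
The box conjunct is the part the F-E shadow presumptively kills at the current record (dag-n18-w1 FILE 1; this seat's FILE 7). CONDITIONAL. [cite: Balaban1987RG1, Thm 1 p.259, (1.21) p.264 and Thm 3 p.264] -/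
theorem runRemAt_of_readOutAt_pin_n18At_scaleAnchor_survContAt (hθ : θ.Admissible F 2) (𝔯 : RateReading₁₃CoPH 2) (g₀ : ℕ → ℝ) (os : List (ULoop F))
    (ℓ : U3Letters₁₁) (hpin : (𝔯.lit F θ hP.toCore g₀ os).u3 = objectsOfRecord₁₃ F 2 θ.toStage13Params ℓ) (kk : ℕ) (hθ₅ : 0 ≤ ℓ.θ₅) (hθ₅1 : ℓ.θ₅ < 1)
    (hD4 : ReadOutAt (Node00.datumOfRecord₁₃SepCoPH F 2 θ hP) (rateCarriersOfRecord₁₃CoPH 𝔯 F θ hP.toCore g₀ os kk).u3)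
    (h18 : N18At (rateCarriersOfRecord₁₃CoPH 𝔯 F θ hP.toCore g₀ os kk).u3)
    (hA : ScaleAnchor (Node00.datumOfRecord₁₃SepCoPH F 2 θ hP).βfun (fun k => θ.cβ * beta0OfJs F κ k))
    {γ₀ : ℝ} (hγ₀ : 0 < γ₀) (hsc : SurvCont (Node00.datumOfRecord₁₃SepCoPH F 2 θ hP).βfun γ₀) :
    RunRemAt F κ θ hP θ.cβ :=
  runRemAt_of_readOutAt_pin_runWindowKernelStepRate_scaleAnchor_survContAt F κ θ hP hθ 𝔯 g₀ os ℓ hpin kk hθ₅ hθ₅1 hD4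
    (runWindowKernelStepRate_of_n18At_pin F 𝔯 θ hP.toCore g₀ os ℓ hpin kk _ h18) hA hγ₀ hsc

end Summit.QuantumFields.YangMills.BalabanUVNodes.N17RunRemAtOfRunWindowKernels

end
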